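import Literature.MathematicalPhysics.QuantumFieldTheory.BalabanImbrieJaffe1984to88.BIJ85RT33

/-!
# `BalabanImbrieJaffe1984to88.BIJ85RT37Normalization` — T. Bałaban, J. Imbrie, A. Jaffe, *Renormalization of the Higgs model:
minimizers, propagators and the stability of mean field theory*, Commun. Math. Phys. **97** (1985) 299–329 [BalabanImbrieJaffe1985],
Sect. 3 p. 306: the NORMALIZATION PROPERTY **(3.7)** `∫ 𝒯e^{−S} 𝒟v𝒟ψ = ∫ e^{−S} 𝒟u𝒟φ` of the renormalization transformation (3.3), PROVED
for the measure-level `𝒯` of file 1/3 `BIJ85RT33` (`RTData.rt`) — the gauge-field half of the normalization (3.13) of T. Bałaban, J. Imbrie,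
A. Jaffe, *Effective action and cluster properties of the abelian Higgs model*, Commun. Math. Phys. **114** (1988) 257–315
[BalabanImbrieJaffe1988] (file 3/3 `BIJ88RT311`).

statement-level skeleton of published theorems with citation tags; proofs where landed; nothing here is a claim about the Yang–Mills mass gap

PDF held: `paper:balaban1985-cmp97-bij-higgs-minimizers` (journal page = PDF page + 298); p. 306 [PDF 8] read on the renders
`run/sessions/literature-prover-lit-balaban-p34-g2-0/folder/pages/c1-p008a.png`, `c1-p008b.png` (poppler ×3).

CITATION HEADER (lean-in-tree rule).  Part of the lit-balaban TYPED SKELETON (HOME `run/shared/lean/pub/lit-balaban/`), PHASE-2 proof seat p34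
(gen 2, unit `lit-balaban-p34-g2`).  Row served: `C1.Eq3.7` of `HOME/lit-balaban-r15/ROWS-C1.md` (owner r15), PROVED; consumed by
`C2.Eq3.13` (owner r18) in `BIJ88RT311`.

THE PRINTED TEXT (p. 306 [PDF 8], verbatim).  *"The integral (3.2) therefore has the normalization property ∫ 𝒯e^{−S} 𝒟v𝒟ψ = ∫ e^{−S} 𝒟u𝒟φ,
(3.7) where 𝒟v𝒟ψ is a measure corresponding to (3.3) but on the L-lattice."*

WHAT IS PROVED.  **(3.7)** `integral_rt`: for every block-averaging datum `D : RTData P j` of file 1/3 ((3.4) tree-like frozen bond set `T`,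
measurable (2.10) `Qu` / (2.6) `Q(u)φ` with the Haar regularity `ac_qU` of `Q(u[T := 1])`), every approximate δ-function `A : ApproxDelta P j`
((3.6) = `BIJ85RT33.deltaH`), and every density `ρ : GaugeField P j U1 → HiggsField P j → ℂ` in place of `e^{−S}` that is jointly measurable,
`𝒟u𝒟φ`-integrable and jointly gauge invariant under (2.7) (`BIJ85RT33.JointInvariant`; for `e^{−S}` of (1.1): `BIJ85Sect1Model.action_gauge`),
`∫𝒟v ∫𝒟ψ (𝒯ρ)(v, ψ) = ∫𝒟u ∫𝒟φ ρ(u, φ)`.  ROUTE (the printed *"therefore"* made explicit): (a) the axial gauge `δ_{Ax}` (3.4) costs nothing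
— `∫𝒟u G(u[T := 1]) = ∫𝒟u G(u)` for the two gauge-invariant functions `G(u) = ∫𝒟φ ρ(u, φ)`, `∫⁻𝒟φ ‖ρ(u, φ)‖` (the cell's measure-level tree
gauge fixing with unit Faddeev–Popov factor, `Balaban1983to89.T4AxialGaugeFixing.map_eq_map_fixBonds` / `lintegral_eq_lintegral_fixBonds`,
fed with `BIJ85RT33.gaugeInvariant_integral` / `gaugeInvariant_lintegral`); (b) `∫ δ_H 𝒟ψ = 1` (3.6) removes the smearing (Fubini/Tonelli
over `𝒟φ𝒟ψ`, `ApproxDelta.integral_K`) and gives the `𝒟u𝒟ψ`-integrability of the smeared density; (c) `∫ δ(v/Qu) 𝒟v = 1` (3.5): the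
`𝒟v𝒟ψ`-integral of the Radon–Nikodym density of each pushed-forward part is its total mass (`Measure.integral_toReal_rnDeriv`), absolute
continuity w.r.t. `𝒟v𝒟ψ` coming from `ac_qU` (`Measure.map_prod_map`, `Measure.AbsolutelyContinuous.prod`); (d) reassembling real and
imaginary, positive and negative parts (`integral_eq_lintegral_pos_part_sub_lintegral_neg_part`, `integral_re_add_im`).
NOT DONE HERE.  Anything about the concrete (2.6)/(2.10)/(3.4) on the torus (see file 1/3); (3.8) ff.  Imports: file 1/3 only (Literature +
Mathlib); no `Prop`-valued facts introduced; standard axioms.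
-/

namespace Literature.MathematicalPhysics.QuantumFieldTheory.BalabanImbrieJaffe1984to88.BIJ85RT37Normalization

open Literature.MathematicalPhysics.QuantumFieldTheory.Balaban1983to89
open BIJ88Sect3Statements (U1 toC)
open BIJ85Sect1Model (HiggsField)
open BIJ85RT33 BIJ85RT33.RTData BIJ85RT33.ApproxDelta
open T4AxialGaugeFixing (TreeOrder fixBonds measurable_fixBonds)
open GaugeField (gaugeAct GaugeInvariant)
open scoped BigOperators ENNReal
open _root_.MeasureTheory _root_.MeasureTheory.Measure Complex

noncomputable section
open Classical

variable {P : Params} {j : ℕ}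

/-! ## The proof of (3.7) -/

section Proof

variable {D : RTData P j} {A : ApproxDelta P j}
variable {ρ : GaugeField P j U1 → HiggsField P j → ℂ}

/-! ### (a) the axial gauge costs nothing: `∫ δ_{Ax}(u) G(u) 𝒟u = ∫ G(u) 𝒟u` for the two gauge-invariant `G` we need -/

/-- kernel: `u ↦ ∫⁻𝒟φ ‖ρ(u, φ)‖` is measurable. [cite: BalabanImbrieJaffe1985, (3.7) p.306] -/
theorem measurable_lintegral_norm (hρm : Measurable (Function.uncurry ρ)) :
    Measurable fun U : GaugeField P j U1 => ∫⁻ φ, ‖ρ U φ‖ₑ :=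
  (hρm.enorm).lintegral_prod_right'

/-- kernel: `u ↦ ∫𝒟φ ρ(u, φ)` is measurable. [cite: BalabanImbrieJaffe1985, (3.7) p.306] -/
theorem measurable_integral (hρm : Measurable (Function.uncurry ρ)) :
    Measurable fun U : GaugeField P j U1 => ∫ φ, ρ U φ :=
  (hρm.stronglyMeasurable.integral_prod_right' (ν := volume)).measurable

/-- THE FADDEEV–POPOV STEP for the absolute value: `∫𝒟u ∫⁻𝒟φ ‖ρ(u[T := 1], φ)‖ = ∫𝒟u ∫⁻𝒟φ ‖ρ(u, φ)‖` (tree gauge fixing at measure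
level, `T4AxialGaugeFixing.lintegral_eq_lintegral_fixBonds`). [cite: BalabanImbrieJaffe1985, (3.4) p.306] -/
theorem lintegral_norm_ax (hρm : Measurable (Function.uncurry ρ)) (hρg : JointInvariant ρ) :
    ∫⁻ U, (∫⁻ φ, ‖ρ (D.ax U) φ‖ₑ) ∂fieldMeasure P j U1 = ∫⁻ U, (∫⁻ φ, ‖ρ U φ‖ₑ) ∂fieldMeasure P j U1 :=
  (T4AxialGaugeFixing.lintegral_eq_lintegral_fixBonds D.treeOrder (measurable_lintegral_norm hρm)
    (gaugeInvariant_lintegral hρm hρg)).symm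

/-- THE FADDEEV–POPOV STEP: `∫𝒟u ∫𝒟φ ρ(u[T := 1], φ) = ∫𝒟u ∫𝒟φ ρ(u, φ)` — *"we specify the axial gauge with δ_{Ax}(u)"* changes nothing
for a gauge-invariant integrand (law form of the tree gauge fixing, `T4AxialGaugeFixing.map_eq_map_fixBonds`, applied to the `ℂ`-valued
gauge-invariant `u ↦ ∫𝒟φ ρ(u, φ)`). [cite: BalabanImbrieJaffe1985, (3.4) p.306] -/
theorem integral_ax (hρm : Measurable (Function.uncurry ρ)) (hρg : JointInvariant ρ) :
    ∫ U, (∫ φ, ρ (D.ax U) φ) ∂fieldMeasure P j U1 = ∫ U, (∫ φ, ρ U φ) ∂fieldMeasure P j U1 := by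
  have hH := measurable_integral hρm
  have hH' : Measurable fun U : GaugeField P j U1 => ∫ φ, ρ (D.ax U) φ := hH.comp D.measurable_ax
  have hlaw : (fieldMeasure P j U1).map (fun U => ∫ φ, ρ U φ) = (fieldMeasure P j U1).map (fun U => ∫ φ, ρ (D.ax U) φ) :=
    T4AxialGaugeFixing.map_eq_map_fixBonds D.treeOrder hH (gaugeInvariant_integral hρm hρg)
  calc ∫ U, (∫ φ, ρ (D.ax U) φ) ∂fieldMeasure P j U1
      = ∫ z, z ∂(fieldMeasure P j U1).map (fun U => ∫ φ, ρ (D.ax U) φ) :=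
        (integral_map hH'.aemeasurable aestronglyMeasurable_id).symm
    _ = ∫ z, z ∂(fieldMeasure P j U1).map (fun U => ∫ φ, ρ U φ) := by rw [hlaw]
    _ = ∫ U, (∫ φ, ρ U φ) ∂fieldMeasure P j U1 := integral_map hH.aemeasurable aestronglyMeasurable_id

/-- kernel: `(u, φ) ↦ ρ(u[T := 1], φ)` is jointly measurable. [cite: BalabanImbrieJaffe1985, (3.4) p.306] -/
theorem measurable_comp_ax (hρm : Measurable (Function.uncurry ρ)) :
    Measurable (Function.uncurry fun U φ => ρ (D.ax U) φ) :=
  hρm.comp (D.measurable_ax.prodMap measurable_id)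

/-- kernel: integrability of `ρ` for `𝒟u𝒟φ` survives the axial gauge fixing (same `L¹` norm, `lintegral_norm_ax`).
[cite: BalabanImbrieJaffe1985, (3.4) p.306] -/
theorem integrable_comp_ax (hρm : Measurable (Function.uncurry ρ)) (hρg : JointInvariant ρ)
    (hρi : Integrable (Function.uncurry ρ) ((fieldMeasure P j U1).prod volume)) :
    Integrable (Function.uncurry fun U φ => ρ (D.ax U) φ) ((fieldMeasure P j U1).prod volume) := by
  refine ⟨(measurable_comp_ax hρm).aestronglyMeasurable, ?_⟩
  have h1 := hρi.2
  unfold HasFiniteIntegral at h1 ⊢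
  rw [lintegral_prod _ (measurable_comp_ax hρm).enorm.aemeasurable]
  rw [lintegral_prod _ hρm.enorm.aemeasurable] at h1
  simp only [Function.uncurry_apply_pair] at h1 ⊢
  rwa [lintegral_norm_ax hρm hρg]

/-! ### (b) the smeared density is measurable and integrable for `𝒟u𝒟ψ`; `∫ δ_H 𝒟ψ = 1` removes the smearing -/

/-- kernel: the integrand `((u, ψ), φ) ↦ ρ(u[T := 1], φ) δ_H(ψ − Q(u[T := 1])φ)` is jointly measurable.
[cite: BalabanImbrieJaffe1985, (3.3) p.306] -/
theorem measurable_smearIntegrand (hρm : Measurable (Function.uncurry ρ)) :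
    Measurable fun q : (GaugeField P j U1 × HiggsField P (j + 1)) × HiggsField P j =>
      ρ (D.ax q.1.1) q.2 * (A.K (D.qH (D.ax q.1.1) q.2) q.1.2 : ℂ) := by
  have hU : Measurable fun q : (GaugeField P j U1 × HiggsField P (j + 1)) × HiggsField P j => D.ax q.1.1 :=
    D.measurable_ax.comp (measurable_fst.comp measurable_fst)
  have h1 : Measurable fun q : (GaugeField P j U1 × HiggsField P (j + 1)) × HiggsField P j => ρ (D.ax q.1.1) q.2 :=
    hρm.comp (hU.prodMk measurable_snd)
  have h2 : Measurable fun q : (GaugeField P j U1 × HiggsField P (j + 1)) × HiggsField P j => A.K (D.qH (D.ax q.1.1) q.2) q.1.2 :=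
    A.measurable_K.comp ((D.measurable_qH.comp (hU.prodMk measurable_snd)).prodMk (measurable_snd.comp measurable_fst))
  exact h1.mul (Complex.measurable_ofReal.comp h2)

/-- kernel: the smeared density `(u, ψ) ↦ G(u[T := 1], ψ)` is jointly measurable. [cite: BalabanImbrieJaffe1985, (3.3) p.306] -/
theorem measurable_smearAx (hρm : Measurable (Function.uncurry ρ)) : Measurable (D.smearAx A ρ) :=
  ((measurable_smearIntegrand hρm).stronglyMeasurable.integral_prod_right' (ν := volume)).measurable

/-- kernel: `∫⁻𝒟ψ ‖ρ(u, φ)‖ δ_H(ψ − c) = ‖ρ(u, φ)‖` (unit mass of `δ_H`). [cite: BalabanImbrieJaffe1985, (3.6) p.306] -/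
theorem lintegral_norm_mul_K (z : ℂ) (c : HiggsField P (j + 1)) :
    ∫⁻ ψ, ‖z * (A.K c ψ : ℂ)‖ₑ = ‖z‖ₑ := by
  have h : ∀ ψ, ‖z * (A.K c ψ : ℂ)‖ₑ = ‖z‖ₑ * ENNReal.ofReal (A.K c ψ) := fun ψ => by
    rw [enorm_mul, enorm_eq_nnnorm (A.K c ψ : ℂ), Complex.nnnorm_real, ← enorm_eq_nnnorm, Real.enorm_eq_ofReal (A.K_nonneg c ψ)]
  simp_rw [h]
  rw [lintegral_const_mul _ (A.measurable_K_left c).ennreal_ofReal, A.lintegral_K, mul_one]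

/-- kernel: for every `u`, `∫⁻𝒟ψ ∫⁻𝒟φ ‖ρ(u, φ) δ_H(ψ − Q(u)φ)‖ = ∫⁻𝒟φ ‖ρ(u, φ)‖` (Tonelli and the unit mass of `δ_H`).
[cite: BalabanImbrieJaffe1985, (3.6) p.306] -/
theorem lintegral_lintegral_norm_smearIntegrand (hρm : Measurable (Function.uncurry ρ)) (U : GaugeField P j U1) :
    ∫⁻ ψ, ∫⁻ φ, ‖ρ U φ * (A.K (D.qH U φ) ψ : ℂ)‖ₑ = ∫⁻ φ, ‖ρ U φ‖ₑ := by
  have hm : Measurable (Function.uncurry fun (ψ : HiggsField P (j + 1)) (φ : HiggsField P j) => ‖ρ U φ * (A.K (D.qH U φ) ψ : ℂ)‖ₑ) := by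
    refine Measurable.enorm ?_
    exact ((measurable_section hρm U).comp measurable_snd).mul
      (Complex.measurable_ofReal.comp (A.measurable_K.comp
        (((D.measurable_qH.comp (measurable_const.prodMk measurable_id)).comp measurable_snd).prodMk measurable_fst)))
  rw [lintegral_lintegral_swap hm.aemeasurable]
  exact lintegral_congr fun φ => lintegral_norm_mul_K (A := A) (ρ U φ) (D.qH U φ)

/-- kernel: the smeared axial density is integrable for `𝒟u𝒟ψ`, its `L¹` norm being at most that of `ρ` for `𝒟u𝒟φ`.
[cite: BalabanImbrieJaffe1985, (3.3) p.306] -/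
theorem integrable_smearAx (hρm : Measurable (Function.uncurry ρ)) (hρg : JointInvariant ρ)
    (hρi : Integrable (Function.uncurry ρ) ((fieldMeasure P j U1).prod volume)) :
    Integrable (D.smearAx A ρ) (fineMeasure P j) := by
  refine ⟨(measurable_smearAx hρm).aestronglyMeasurable, ?_⟩
  have hfin := (integrable_comp_ax (D := D) hρm hρg hρi).2
  unfold HasFiniteIntegral at hfin ⊢
  rw [lintegral_prod _ (measurable_comp_ax (D := D) hρm).enorm.aemeasurable] at hfin
  unfold fineMeasure
  rw [lintegral_prod _ (measurable_smearAx (D := D) (A := A) hρm).enorm.aemeasurable]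
  refine lt_of_le_of_lt (lintegral_mono fun U => ?_) hfin
  calc ∫⁻ ψ, ‖D.smearAx A ρ (U, ψ)‖ₑ ≤ ∫⁻ ψ, ∫⁻ φ, ‖ρ (D.ax U) φ * (A.K (D.qH (D.ax U) φ) ψ : ℂ)‖ₑ :=
        lintegral_mono fun ψ => enorm_integral_le_lintegral_enorm _
    _ = ∫⁻ φ, ‖ρ (D.ax U) φ‖ₑ := lintegral_lintegral_norm_smearIntegrand hρm (D.ax U)

/-- kernel: at a gauge field `u` at which `ρ(u, ·)` is `𝒟φ`-integrable, `∫𝒟ψ G(u, ψ) = ∫𝒟φ ρ(u, φ)` — Fubini and `∫ δ_H 𝒟ψ = 1`.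
[cite: BalabanImbrieJaffe1985, (3.6) p.306] -/
theorem integral_smear_of_integrable (hρm : Measurable (Function.uncurry ρ)) (U : GaugeField P j U1)
    (hU : Integrable (ρ U)) : ∫ ψ, D.smear A ρ U ψ = ∫ φ, ρ U φ := by
  have hm : Measurable (Function.uncurry fun (ψ : HiggsField P (j + 1)) (φ : HiggsField P j) => ρ U φ * (A.K (D.qH U φ) ψ : ℂ)) :=
    ((measurable_section hρm U).comp measurable_snd).mul
      (Complex.measurable_ofReal.comp (A.measurable_K.comp
        (((D.measurable_qH.comp (measurable_const.prodMk measurable_id)).comp measurable_snd).prodMk measurable_fst)))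
  have hint : Integrable (Function.uncurry fun (ψ : HiggsField P (j + 1)) (φ : HiggsField P j) => ρ U φ * (A.K (D.qH U φ) ψ : ℂ))
      ((volume : Measure (HiggsField P (j + 1))).prod volume) := by
    refine ⟨hm.aestronglyMeasurable, ?_⟩
    unfold HasFiniteIntegral
    rw [lintegral_prod _ hm.enorm.aemeasurable]
    simp only [Function.uncurry_apply_pair]
    rw [lintegral_lintegral_norm_smearIntegrand hρm U]
    exact hU.2
  unfold smear
  rw [integral_integral_swap hint]
  refine integral_congr_ae (Filter.Eventually.of_forall fun φ => ?_)
  simp only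
  rw [integral_const_mul, A.integral_K_complex, mul_one]

/-- **The `𝒟φ𝒟ψ`-integral of (3.3) at every block gauge field**: `∫𝒟u𝒟ψ G(u[T := 1], ψ) = ∫𝒟u ∫𝒟φ ρ(u, φ)` — `δ_H` integrates to one
(3.6) and the axial gauge fixing (3.4) costs nothing. [cite: BalabanImbrieJaffe1985, (3.7) p.306] -/
theorem integral_smearAx (hρm : Measurable (Function.uncurry ρ)) (hρg : JointInvariant ρ)
    (hρi : Integrable (Function.uncurry ρ) ((fieldMeasure P j U1).prod volume)) :
    ∫ p, D.smearAx A ρ p ∂fineMeasure P j = ∫ U, (∫ φ, ρ U φ) ∂fieldMeasure P j U1 := by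
  have h := integral_prod _ (integrable_smearAx (D := D) (A := A) hρm hρg hρi)
  unfold fineMeasure at h ⊢
  rw [h, ← integral_ax (D := D) hρm hρg]
  refine integral_congr_ae ?_
  filter_upwards [(integrable_comp_ax (D := D) hρm hρg hρi).prod_right_ae] with U hU
  exact integral_smear_of_integrable hρm (D.ax U) hU

/-! ### (c) `∫ δ(v/Qu) 𝒟v = 1`: the total mass of the Radon–Nikodym densities -/

/-- kernel: the pushed-forward law of an integrable weight is a finite measure. [cite: BalabanImbrieJaffe1985, (3.5) p.306] -/
theorem isFiniteMeasure_pushLaw {h : GaugeField P j U1 × HiggsField P (j + 1) → ℝ} (hh : Integrable h (fineMeasure P j)) :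
    IsFiniteMeasure (D.pushLaw h) := by
  haveI := isFiniteMeasure_withDensity_ofReal hh.2
  unfold pushLaw
  infer_instance

/-- kernel: the pushed-forward law is ABSOLUTELY CONTINUOUS w.r.t. `𝒟v𝒟ψ` — this is where the Haar regularity `ac_qU` of the block
average enters. [cite: BalabanImbrieJaffe1985, (3.5) p.306] -/
theorem pushLaw_absolutelyContinuous (h : GaugeField P j U1 × HiggsField P (j + 1) → ℝ) :
    D.pushLaw h ≪ blockMeasure P j := by
  have h1 : D.pushLaw h ≪ (fineMeasure P j).map D.blockMap :=
    (withDensity_absolutelyContinuous _ _).map D.measurable_blockMap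
  have h2 : (fineMeasure P j).map D.blockMap = ((fieldMeasure P j U1).map fun U => D.qU (D.ax U)).prod volume := by
    unfold fineMeasure blockMap
    rw [← Measure.map_prod_map _ _ D.measurable_qU_ax measurable_id, Measure.map_id]
  rw [h2] at h1
  exact h1.trans (Measure.AbsolutelyContinuous.prod D.ac_qU (Measure.AbsolutelyContinuous.refl _))

/-- kernel: total mass of the pushed-forward law `= ∫⁻ h⁺ 𝒟u𝒟ψ`. [cite: BalabanImbrieJaffe1985, (3.5) p.306] -/
theorem pushLaw_univ (h : GaugeField P j U1 × HiggsField P (j + 1) → ℝ) :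
    D.pushLaw h Set.univ = ∫⁻ p, ENNReal.ofReal (h p) ∂fineMeasure P j := by
  unfold pushLaw
  rw [Measure.map_apply D.measurable_blockMap MeasurableSet.univ, Set.preimage_univ, withDensity_apply _ MeasurableSet.univ,
    Measure.restrict_univ]

/-- **`∫ δ(v/Qu) 𝒟v = 1`, Radon–Nikodym form**: for a real `𝒟u𝒟ψ`-integrable weight `h`, the `𝒟v𝒟ψ`-integral of the Radon–Nikodym density
of its pushed-forward law is `∫ h 𝒟u𝒟ψ` (`Measure.integral_toReal_rnDeriv` for the two parts; absolute continuity from `ac_qU`).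
[cite: BalabanImbrieJaffe1985, (3.5) p.306] -/
theorem integral_rnReal {h : GaugeField P j U1 × HiggsField P (j + 1) → ℝ} (hh : Integrable h (fineMeasure P j)) :
    ∫ q, D.rnReal h q ∂blockMeasure P j = ∫ p, h p ∂fineMeasure P j := by
  haveI := isFiniteMeasure_pushLaw (D := D) hh
  haveI := isFiniteMeasure_pushLaw (D := D) hh.neg
  unfold rnReal
  rw [integral_sub Measure.integrable_toReal_rnDeriv Measure.integrable_toReal_rnDeriv,
    Measure.integral_toReal_rnDeriv (pushLaw_absolutelyContinuous (D := D) h),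
    Measure.integral_toReal_rnDeriv (pushLaw_absolutelyContinuous (D := D) fun p => -h p), measureReal_def, measureReal_def,
    pushLaw_univ, pushLaw_univ, integral_eq_lintegral_pos_part_sub_lintegral_neg_part hh]

/-- kernel: the Radon–Nikodym density of a real integrable weight is `𝒟v𝒟ψ`-integrable. [cite: BalabanImbrieJaffe1985, (3.5) p.306] -/
theorem integrable_rnReal {h : GaugeField P j U1 × HiggsField P (j + 1) → ℝ} (hh : Integrable h (fineMeasure P j)) :
    Integrable (D.rnReal h) (blockMeasure P j) := by
  haveI := isFiniteMeasure_pushLaw (D := D) hh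
  haveI := isFiniteMeasure_pushLaw (D := D) hh.neg
  exact Measure.integrable_toReal_rnDeriv.sub Measure.integrable_toReal_rnDeriv

/-- kernel: `𝒯ρ` is `𝒟v𝒟ψ`-integrable. [cite: BalabanImbrieJaffe1985, (3.3) p.306] -/
theorem integrable_rt (hρm : Measurable (Function.uncurry ρ)) (hρg : JointInvariant ρ)
    (hρi : Integrable (Function.uncurry ρ) ((fieldMeasure P j U1).prod volume)) :
    Integrable (Function.uncurry (D.rt A ρ)) (blockMeasure P j) := by
  have hG := integrable_smearAx (D := D) (A := A) hρm hρg hρi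
  have hre : Integrable (fun p => (D.smearAx A ρ p).re) (fineMeasure P j) := hG.re
  have him : Integrable (fun p => (D.smearAx A ρ p).im) (fineMeasure P j) := hG.im
  have h1 : Integrable (fun q => (D.rnReal (fun p => (D.smearAx A ρ p).re) q : ℂ)) (blockMeasure P j) :=
    (integrable_rnReal hre).ofReal
  have h2 : Integrable (fun q => (D.rnReal (fun p => (D.smearAx A ρ p).im) q : ℂ) * I) (blockMeasure P j) :=
    (integrable_rnReal him).ofReal.mul_const I
  exact h1.add h2

/-- **`∫ (𝒯ρ) 𝒟v𝒟ψ = ∫ G(u[T := 1], ψ) 𝒟u𝒟ψ`** (product-integral form): the δ-function `δ(v/Qu)` integrates to one.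
[cite: BalabanImbrieJaffe1985, (3.7) p.306] -/
theorem integral_rt_prod (hρm : Measurable (Function.uncurry ρ)) (hρg : JointInvariant ρ)
    (hρi : Integrable (Function.uncurry ρ) ((fieldMeasure P j U1).prod volume)) :
    ∫ q, Function.uncurry (D.rt A ρ) q ∂blockMeasure P j = ∫ p, D.smearAx A ρ p ∂fineMeasure P j := by
  have hG := integrable_smearAx (D := D) (A := A) hρm hρg hρi
  have hre : Integrable (fun p => (D.smearAx A ρ p).re) (fineMeasure P j) := hG.re
  have him : Integrable (fun p => (D.smearAx A ρ p).im) (fineMeasure P j) := hG.im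
  have h1 : Integrable (fun q => (D.rnReal (fun p => (D.smearAx A ρ p).re) q : ℂ)) (blockMeasure P j) :=
    (integrable_rnReal hre).ofReal
  have h2 : Integrable (fun q => (D.rnReal (fun p => (D.smearAx A ρ p).im) q : ℂ) * I) (blockMeasure P j) :=
    (integrable_rnReal him).ofReal.mul_const I
  change ∫ q, ((D.rnReal (fun p => (D.smearAx A ρ p).re) q : ℂ) + (D.rnReal (fun p => (D.smearAx A ρ p).im) q : ℂ) * I)
    ∂blockMeasure P j = _
  rw [integral_add h1 h2, integral_mul_const, integral_complex_ofReal, integral_complex_ofReal, integral_rnReal hre,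
    integral_rnReal him]
  exact integral_re_add_im_complex hG

end Proof

/-- **(3.7)** p. 306 [PDF 8], verbatim: *"The integral (3.2) therefore has the normalization property ∫ 𝒯e^{−S} 𝒟v𝒟ψ = ∫ e^{−S} 𝒟u𝒟φ, (3.7)
where 𝒟v𝒟ψ is a measure corresponding to (3.3) but on the L-lattice."* — PROVED for the measure-level 𝒯 of (3.3) (`rt`), for every
block-averaging datum `RTData` ((3.4) tree-like `T`, measurable (2.6)/(2.10) with the Haar regularity `ac_qU`), every approximate δ-function
`ApproxDelta` ((3.6) = `deltaH`), and every density `ρ` in place of `e^{−S}` that is jointly measurable, `𝒟u𝒟φ`-integrable and jointly gauge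
invariant under (2.7) (for `e^{−S}`: `BIJ85Sect1Model.action_gauge`): `∫𝒟v ∫𝒟ψ (𝒯ρ)(v, ψ) = ∫𝒟u ∫𝒟φ ρ(u, φ)`.  The three normalizations at
work: `∫ δ_H 𝒟ψ = 1` (`ApproxDelta.integral_K`), `∫ δ(v/Qu) 𝒟v = 1` (`integral_rnReal`), `∫ δ_{Ax}(u)(·)𝒟u = ∫ (·)𝒟u` on gauge-invariant
functions (`integral_ax`, the cell's `T4AxialGaugeFixing`). [cite: BalabanImbrieJaffe1985, (3.7) p.306] -/
theorem integral_rt (D : RTData P j) (A : ApproxDelta P j) (ρ : GaugeField P j U1 → HiggsField P j → ℂ) (hρm : Measurable (Function.uncurry ρ)) (hρg : JointInvariant ρ)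
    (hρi : Integrable (Function.uncurry ρ) ((fieldMeasure P j U1).prod volume)) :
    ∫ V, (∫ ψ, D.rt A ρ V ψ) ∂fieldMeasure P (j + 1) U1 = ∫ U, (∫ φ, ρ U φ) ∂fieldMeasure P j U1 := by
  have h := integral_prod _ (integrable_rt (D := D) (A := A) hρm hρg hρi)
  simp only [Function.uncurry_apply_pair] at h
  rw [← h]
  change ∫ q, Function.uncurry (D.rt A ρ) q ∂blockMeasure P j = _
  rw [integral_rt_prod hρm hρg hρi, integral_smearAx hρm hρg hρi]

end

end Literature.MathematicalPhysics.QuantumFieldTheory.BalabanImbrieJaffe1984to88.BIJ85RT37Normalization
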